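import Mathlib
import Summits.NavierStokesRegularity.FluidComputer.SkewCutGalerkinPerturbation

/-!
# Skew-cut certificate: the bracket ends are not eigenvalues (SKEWCUT-CERT Thm 1′ (a), injectivity
half, perturbed-resolvent form) and the open-bracket eigenpair
(instab4 g4 — implementation 2 of the skew-cut X0 certifier, cell `ns-blowup`, 2026-08-26)

HONEST FRAMING (human ruling D-0035): nothing here is a claim about Navier–Stokes blow-up.
WHAT THIS IS NOT: not NS evidence. MODEL lane (the consumer is the linear operator «NS linearised
about the forced ABC flow, class II»). Companion of `SkewCutGalerkinPerturbation.lean` (p439680), in whose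
coordinates the operator `L = L₀ + A` is presented by the free resolvent `S₀ = (x₀ − L₀)⁻¹` and the
relative bound `T = A S₀`: `D(L) = range S₀`, `L (S₀ w) = x₀ S₀ w − w + T w`. In these coordinates

  `(a − L)(S₀ w) = R_a w`,  `R_a := 1 − T − (x₀ − a) S₀`  (a BOUNDED operator on `H`),

so «`a` is not an eigenvalue of `L`» — the hypothesis `∀ w, x₀ S₀ w − w + T w = a S₀ w → S₀ w = 0` of
`SkewCutGalerkinPerturbation.exists_eigenpair_of_galerkin_brackets` — is the injectivity of `R_a`
(`not_eigenvalue_of_injective`).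

`injective_of_head_tail_coercive` is the method note's Theorem 1′ (a) (uniqueness half; §3 STEP 3
«(x − L)u = 0 ⇒ u_H = −A⁻¹B u_T and z(u_T, u_T) = 0 ⇒ u_T = 0 ⇒ u = 0») for ANY bounded `R` on a
Hilbert space split as head `U` ⊕ tail `Uᗮ` (`U` = the cube truncation `|k|_∞ ≤ K`, a complete
subspace with star projection `P`): if the head compression `u ↦ P R u` of `U` is injective with a
right inverse `Ainv` on `U` (the certified `det A⁽ᴷ⁾(a) ≠ 0`), and the SCHUR FORM is coercive on the
tail against `S₀`,
  `μ ‖S₀ w‖² ≤ Re ⟪R w − R (Ainv (P (R w))), S₀ w⟫`  for `w ∈ Uᗮ`, `μ > 0`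
(= `Re z(v, v) ≥ μ‖v‖²`, `v = S₀ w`, of §3 STEP 2 — for the model this is the certified
`MU2_K > 0` plus the tail constant `a + ν(K+2)² − √2 > 0`, via skewness (F1), the strain bound (F2)
and locality (F3); that tail-form computation is model-specific and not done here), and `S₀` is
injective, then `R` is injective. No surjectivity / Lax–Milgram is needed for the OPEN bracket: the
compact resolvent of `exists_eigenpair_of_galerkin_brackets` lives at the base point `x₀`, not at the
bracket ends. `exists_eigenpair_Ioo_of_galerkin_brackets` assembles the open-bracket statement.

Mathlib + `SkewCutGalerkinPerturbation`; no new definitions. (The block algebra is the Hilbert-space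
form of instab3's `SkewCutSchurCoercivity.injective_of_schur_injective`, with the Schur map's
injectivity supplied by coercivity.)
-/

namespace Summit.NavierStokesRegularity.FluidComputer.SkewCutGalerkinInjectivity

open Submodule
open scoped InnerProductSpace

variable {𝕜 H : Type*} [RCLike 𝕜] [NormedAddCommGroup H] [InnerProductSpace 𝕜 H]

/-! ### Head–tail block argument -/

/-- **Theorem 1′ (a), injectivity half, abstract.** `R` bounded on `H = U ⊕ Uᗮ` (`P` the star
projection onto the complete subspace `U`); the head compression `u ↦ P (R u)` is injective on `U`
and has a right inverse `Ainv` on `U` with values in `U`; the Schur form is coercive on the tail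
against an injective `S₀`: `μ‖S₀ w‖² ≤ Re⟪R w − R (Ainv (P (R w))), S₀ w⟫` for `w ∈ Uᗮ`, `μ > 0`.
Then `R w = 0 ⇒ w = 0`. -/
theorem injective_of_head_tail_coercive (R S₀ : H →L[𝕜] H) (hS₀ : ∀ w, S₀ w = 0 → w = 0)
    (U : Submodule 𝕜 H) [U.HasOrthogonalProjection] (Ainv : H → H)
    (hAinvU : ∀ y ∈ U, Ainv y ∈ U)
    (hAinv : ∀ y ∈ U, U.starProjection (R (Ainv y)) = y)
    (hAinj : ∀ u ∈ U, U.starProjection (R u) = 0 → u = 0)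
    {μ : ℝ} (hμ : 0 < μ)
    (hcoer : ∀ w ∈ Uᗮ, μ * ‖S₀ w‖ ^ 2 ≤
      RCLike.re ⟪R w - R (Ainv (U.starProjection (R w))), S₀ w⟫_𝕜)
    (w : H) (hw : R w = 0) : w = 0 := by
  set P := U.starProjection with hP
  -- split `w = wh + wt`
  set wh : H := P w with hwh
  set wt : H := w - P w with hwt
  have hwhU : wh ∈ U := U.starProjection_apply_mem w
  have hwtU : wt ∈ Uᗮ := U.sub_starProjection_mem_orthogonal w
  have hsplit : w = wh + wt := by rw [hwh, hwt]; abel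
  have hRsum : R wh + R wt = 0 := by rw [← map_add, ← hsplit, hw]
  -- head equation: `P (R wh) = -y`, `y := P (R wt) ∈ U`
  set y : H := P (R wt) with hy
  have hyU : y ∈ U := U.starProjection_apply_mem _
  have h1 : P (R wh) = -y := by
    have h := congrArg P hRsum
    rw [map_add, map_zero] at h
    exact eq_neg_of_add_eq_zero_left h
  -- `wh + Ainv y ∈ U` is killed by the head compression, hence vanishes
  have hu : wh + Ainv y = 0 := by
    refine hAinj _ (U.add_mem hwhU (hAinvU y hyU)) ?_
    rw [map_add, map_add, h1, hAinv y hyU, neg_add_cancel]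
  have hwh' : wh = -Ainv y := eq_neg_of_add_eq_zero_left hu
  -- tail equation in Schur form: `R wt - R (Ainv (P (R wt))) = 0`
  have htail : R wt - R (Ainv (P (R wt))) = 0 := by
    rw [← hy, sub_eq_add_neg, ← map_neg, ← hwh', add_comm]
    exact hRsum
  -- coercivity ⇒ `S₀ wt = 0` ⇒ `wt = 0`
  have hc := hcoer wt hwtU
  rw [htail, inner_zero_left, map_zero] at hc
  have hS0 : S₀ wt = 0 := by
    have h2 : ‖S₀ wt‖ ^ 2 ≤ 0 := by
      have h3 : μ * ‖S₀ wt‖ ^ 2 ≤ μ * 0 := by rw [mul_zero]; exact hc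
      exact le_of_mul_le_mul_left h3 hμ
    have h4 : ‖S₀ wt‖ ^ 2 = 0 := le_antisymm h2 (sq_nonneg _)
    exact norm_eq_zero.mp (pow_eq_zero_iff two_ne_zero |>.mp h4)
  have hwt0 : wt = 0 := hS₀ wt hS0
  -- then `y = 0`, `Ainv 0 = 0`, `wh = 0`
  have hy0 : y = 0 := by rw [hy, hwt0, map_zero, map_zero]
  have hA0 : Ainv 0 = 0 :=
    hAinj _ (hAinvU 0 U.zero_mem) (hAinv 0 U.zero_mem)
  rw [hsplit, hwt0, add_zero, hwh', hy0, hA0, neg_zero]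

/-! ### Resolvent coordinates: `(a − L)(S₀ w) = R_a w`, `R_a = 1 − T − (x₀ − a) S₀` -/

omit [RCLike 𝕜] [InnerProductSpace 𝕜 H] in
/-- The eigen-equation `x₀ S₀ w − w + T w = a S₀ w` (`L (S₀ w) = a S₀ w`) says exactly
`R_a w = 0` with `R_a := 1 − T − (x₀ − a) S₀`. -/
theorem eigen_iff_resolventCoord_eq_zero {𝕜 : Type*} [RCLike 𝕜] [InnerProductSpace 𝕜 H]
    (S₀ T : H →L[𝕜] H) (x₀ a : 𝕜) (w : H) :
    x₀ • S₀ w - w + T w = a • S₀ w ↔ ((1 : H →L[𝕜] H) - T - (x₀ - a) • S₀) w = 0 := by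
  simp only [sub_apply, FunLike.coe_smul, Pi.smul_apply, one_apply_eq_self,
    sub_smul]
  constructor
  · intro h
    calc w - T w - (x₀ • S₀ w - a • S₀ w) = -(x₀ • S₀ w - w + T w - a • S₀ w) := by abel
      _ = 0 := by rw [h, sub_self, neg_zero]
  · intro h
    have : x₀ • S₀ w - w + T w - a • S₀ w = 0 := by
      calc x₀ • S₀ w - w + T w - a • S₀ w = -(w - T w - (x₀ • S₀ w - a • S₀ w)) := by abel
        _ = 0 := by rw [h, neg_zero]
    exact sub_eq_zero.mp this

/-- **`a` is not an eigenvalue of `L` when `R_a` is injective** — the hypothesis shape of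
`SkewCutGalerkinPerturbation.exists_eigenpair_of_galerkin_brackets`. -/
theorem not_eigenvalue_of_injective (S₀ T : H →L[𝕜] H) (x₀ a : 𝕜)
    (hinj : ∀ w, ((1 : H →L[𝕜] H) - T - (x₀ - a) • S₀) w = 0 → w = 0) :
    ∀ w : H, x₀ • S₀ w - w + T w = a • S₀ w → S₀ w = 0 := fun w hw => by
  rw [hinj w ((eigen_iff_resolventCoord_eq_zero S₀ T x₀ a w).1 hw), map_zero]

/-- **Theorem 1′ (a) for `L` in resolvent coordinates**: head compression of
`R_a = 1 − T − (x₀ − a) S₀` injective on the truncation `U` with a right inverse there, Schur form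
coercive on `Uᗮ` against `S₀`, `S₀` injective ⇒ `a` is not an eigenvalue of `L`. -/
theorem not_eigenvalue_of_head_tail_coercive (S₀ T : H →L[𝕜] H) (hS₀ : ∀ w, S₀ w = 0 → w = 0)
    (x₀ a : 𝕜) (U : Submodule 𝕜 H) [U.HasOrthogonalProjection] (Ainv : H → H)
    (hAinvU : ∀ y ∈ U, Ainv y ∈ U)
    (hAinv : ∀ y ∈ U, U.starProjection (((1 : H →L[𝕜] H) - T - (x₀ - a) • S₀) (Ainv y)) = y)
    (hAinj : ∀ u ∈ U, U.starProjection (((1 : H →L[𝕜] H) - T - (x₀ - a) • S₀) u) = 0 → u = 0)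
    {μ : ℝ} (hμ : 0 < μ)
    (hcoer : ∀ w ∈ Uᗮ, μ * ‖S₀ w‖ ^ 2 ≤
      RCLike.re ⟪((1 : H →L[𝕜] H) - T - (x₀ - a) • S₀) w -
        ((1 : H →L[𝕜] H) - T - (x₀ - a) • S₀)
          (Ainv (U.starProjection (((1 : H →L[𝕜] H) - T - (x₀ - a) • S₀) w))), S₀ w⟫_𝕜) :
    ∀ w : H, x₀ • S₀ w - w + T w = a • S₀ w → S₀ w = 0 :=
  not_eigenvalue_of_injective S₀ T x₀ a
    (injective_of_head_tail_coercive _ S₀ hS₀ U Ainv hAinvU hAinv hAinj hμ hcoer)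

/-! ### The open-bracket eigenpair -/

/-- **SKEWCUT-CERT Thm 2 + Thm 1′ (a) assembled in resolvent coordinates.** Under the hypotheses of
`SkewCutGalerkinPerturbation.exists_eigenpair_of_galerkin_brackets` (compact free resolvent, `1 − T`
invertible, exhausting truncations, section eigen-equations with `x_n ∈ [a, c]`, graph-norm bound)
AND injectivity of `R_a`, `R_c` (each e.g. by `injective_of_head_tail_coercive` from a certified head
and a coercive tail), `L = L₀ + A` has an eigenpair `x₀ S₀ w − w + T w = λ S₀ w`, `‖S₀ w‖ = 1`, with
`λ` in the OPEN bracket `(a, c)`. -/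
theorem exists_eigenpair_Ioo_of_galerkin_brackets [CompleteSpace H]
    (S₀ : H →L[𝕜] H) (hS₀ : IsCompactOperator S₀) (T : H →L[𝕜] H) (hT : IsUnit (1 - T))
    (U : ℕ → Submodule 𝕜 H) [∀ n, (U n).HasOrthogonalProjection] (hU : Monotone U)
    (hU' : ⊤ ≤ (⨆ n, U n).topologicalClosure)
    (u : ℕ → H) (hu : ∀ n, u n ∈ U n) (hv : ∀ n, S₀ (u n) ∈ U n)
    (hv1 : ∀ n, ‖S₀ (u n)‖ = 1) {C : ℝ} (hC : ∀ n, ‖u n‖ ≤ C)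
    (x₀ : ℝ) (xs : ℕ → ℝ) {a c : ℝ} (hxs : ∀ n, xs n ∈ Set.Icc a c)
    (hGal : ∀ n, (U n).starProjection ((x₀ : 𝕜) • S₀ (u n) - u n + T (u n)) =
      (xs n : 𝕜) • S₀ (u n))
    (hinj_a : ∀ w, ((1 : H →L[𝕜] H) - T - ((x₀ : 𝕜) - (a : 𝕜)) • S₀) w = 0 → w = 0)
    (hinj_c : ∀ w, ((1 : H →L[𝕜] H) - T - ((x₀ : 𝕜) - (c : 𝕜)) • S₀) w = 0 → w = 0) :
    ∃ lam ∈ Set.Ioo a c, ∃ w : H, ‖S₀ w‖ = 1 ∧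
      (x₀ : 𝕜) • S₀ w - w + T w = (lam : 𝕜) • S₀ w := by
  obtain ⟨lam, -, w, hw1, hw, hIoo⟩ :=
    SkewCutGalerkinPerturbation.exists_eigenpair_of_galerkin_brackets S₀ hS₀ T hT U hU hU' u hu hv
      hv1 hC x₀ xs hxs hGal
  exact ⟨lam, hIoo (not_eigenvalue_of_injective S₀ T _ _ hinj_a)
    (not_eigenvalue_of_injective S₀ T _ _ hinj_c), w, hw1, hw⟩

end Summit.NavierStokesRegularity.FluidComputer.SkewCutGalerkinInjectivity
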